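import Summits.ResolutionOfSingularities.ResolutionOfSingularities.Theorems.HilbertSamuelEliminationCampaignW42RidgeConfinesOfPermissible
import Summits.ResolutionOfSingularities.ResolutionOfSingularities.Theorems.HilbertSamuelEliminationCampaignW42RidgeDietel
import HarnessLib

/-!
# [OURS · L1 W4.2] The proposed typed signature of the informal crux `RidgeConfinement` (stmt-ResolutionOfSingularities-17845),
# `CampaignW42RidgeConfinement p = CampaignW42RidgeConfines p ∧ RidgeDimMonotone p`, holds MODULO ONE NAMED FACT
# (F-54, Dietel 2015 Thm. (8.2.7) (ii): the ridge-dimension drop) — the confinement conjunct being PROVED unconditionally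
# (campaign s42, cell res-hironaka; `--supports`)

HONEST FRAMING. OURS (slot W4.2, prover res-L1-s42-pv-1, gen 3): a two-line assembly.
* The CONFINEMENT conjunct `CampaignW42RidgeConfines p` is a THEOREM of the tree for every `p`
  (`CampaignW42.campaignW42RidgeConfines_holds`, `…RidgeConfinesOfPermissible.lean`, p513085 — this campaign's chain:
  Bennett equality at the line of the fibre cone ⟹ cone theorem at an arbitrary point ⟹ Hironaka–Grothendieck at the
  near point ⟹ transport to the minimal generators ⟹ stalks of the blow-up).
* The MONOTONICITY conjunct `CampaignW42.RidgeDimMonotone p` is res-L1-type-o1's bridge `ridgeDimMonotone_of_dietel`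
  (`…RidgeDietel.lean`) from the named Literature fact `Dietel2015_nearPoint_ridge` (F-54: B. Dietel, Dissertation
  Regensburg 2015, Thm. (8.2.7) (ii) — `dim F_{x'}(X') + tr.deg ≤ dim F_x(X)` at near points; THESIS-flagged source,
  statement-only in the tree), taken BY NAME as a hypothesis: the result below is CONDITIONAL on F-54 and on nothing else.
* `campaignW42RidgeConfinement_of_dietel : Dietel2015_nearPoint_ridge → ∀ p, CampaignW42RidgeConfinement p`.

NOTHING here is a statement of H. Hironaka's manuscript [Hironaka2017]; AI-produced, AI review is weaker than expert
review. The item stmt-17845 stays informal support by the planner's ruling (RULINGS v3.10-3 (b)); if a typed item with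
signature `∀ p, CampaignW42RidgeConfinement p` (or its first conjunct) is filed, this file / p513085 are its closing shape.
References (orientation only): B. Dietel, Dissertation Regensburg (2015), Thm. (8.2.7) (ii); V. Cossart, U. Jannsen,
S. Saito, LNM 2270 (2020), Thm. 3.14, Rem. 18.29.
-/

noncomputable section

-- single-conjunct summit: the doubled namespace component `ResolutionOfSingularities` is mandated
set_option linter.dupNamespace false

open Literature.AlgebraicGeometry.Resolution

namespace Summit.ResolutionOfSingularities.ResolutionOfSingularities.Theorems

namespace CampaignW42

universe u

/-- **`CampaignW42RidgeConfinement p` modulo F-54.** The proposed typed signature of stmt-17845 — confinement of near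
points to the projectivised ridge AND monotonicity of the ridge dimension, for reduced separated schemes of finite type
over a field of characteristic `p`, permissible centres, all residue fields — holds for every `p` assuming only the named
fact `Dietel2015_nearPoint_ridge` (for the monotonicity conjunct; the confinement conjunct is unconditional,
`campaignW42RidgeConfines_holds`). [cite: Dietel2015, Thm. (8.2.7) (ii) p. 105] [cite: CossartJannsenSaito2020, Thm. 3.14] -/
theorem campaignW42RidgeConfinement_of_dietel (h54 : Dietel2015_nearPoint_ridge.{u}) (p : ℕ) :
    CampaignW42RidgeConfinement.{u} p :=
  ⟨campaignW42RidgeConfines_holds p, ridgeDimMonotone_of_dietel h54 p⟩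

/-- **The confinement conjunct alone, for all `p` at once** (closing shape for an item with signature
`∀ p, CampaignW42RidgeConfines p`). [cite: CossartJannsenSaito2020, Thm. 3.14] [cite: Giraud1975, Cor. 2.4] -/
theorem campaignW42RidgeConfines_all : ∀ p : ℕ, CampaignW42RidgeConfines.{u} p :=
  fun p => campaignW42RidgeConfines_holds p

end CampaignW42

end Summit.ResolutionOfSingularities.ResolutionOfSingularities.Theorems

end
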